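import Mathlib
import HarnessLib
import Literature.Probability.LatticeModels.TorusMomentumProductGrid
import Summits.HubbardSuperconductivity.HubbardSuperconductivity.Theorems.KLProgrammeKLRegimeVolumeLimitTannery
import Summits.HubbardSuperconductivity.HubbardSuperconductivity.Theorems.KLProgrammeKLRegimeVolumeLimitSunsetFrequencySum

/-!
# Route `KLProgramme` — child `KLRegimeVolumeLimitV7` (stmt-HubbardSuperconductivity-19665): the ORDER-`U²` (SUNSET) RUNG of the
# volume-limit slot, MODEL-FREE — the finite-volume two-loop functional of any admissible symbol family satisfies the three clauses
# of `FinalTwoLegVolLimit` (cell gate-hubbard-kl, seat hubbard-kl-k3c4-p1; plan g10 ruling (α) 16:19:44Z, re-point (2): «the T3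
# WITNESS for 19665»; split with k3c5-p2 STATUS 16:41:25Z: he instantiates it with the true carrier's `U²`-coefficient)

THE OBJECT.  For a symbol family `g : ℤ → (Fin 2 → ℝ) → ℂ` (one momentum symbol per fermionic Matsubara integer; the instance of
record is `g a x = (-iω_a + e_K(x))⁻¹`, `ω_a = π(2a+1)/β`, at a fixed admissible frame `K`) the finite-volume SUNSET functional at
volume `(L, M)` and external frequency–momentum `(ω, k⃗)`, `n = matsubaraInt M ω`, is

  `klSunset L M β g (ω, k⃗) σ = Σ_{(a,b) ∈ ℤ²} klSunsetTerm … (a,b) …`,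
  `klSunsetTerm … (a,b) (ω,k⃗) σ = [a, b, n+b-a ∈ [-M, M-1]] · β⁻² · L⁻² Σ_p L⁻² Σ_q g_a(p_p) g_b(p_q) g_{n+b-a}(p_{k⃗+q-p})`

(the Matsubara cutoff keeps `2M` frequencies `[-M, M-1]`, `HubbardFreeCovariance.matsubaraInt`; momentum conservation at the two
vertices is exact on the discrete torus: the third line carries the torus site `k⃗ + q - p`).  ADMISSIBLE symbol families: each `g_a`
continuous and `2π`-periodic, and `‖g_a(x)‖ ≤ C/|a + ½|` (the instance: `|{-iω_a + e}| ≥ |ω_a| = (2π/β)|a+½|`, `C = β/2π`).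

THE THEOREM `klSunset_volLimit`: for every admissible family, every `β > 0` and EVERY threshold function `Mstar`, the three clauses of
the VL text hold for `klSunset`: a momentum-continuous limit `Σ∞ = klSunsetLimit β g` (`β⁻²(2π)⁻⁴ Σ_{(a,b)} ∫_{[-π,π]⁴} g_a g_b g_{n+b-a}`),
an `n`-UNIFORM bound `B = 3 β⁻² C³ G²` (`G = Σ_a |a+½|^{-3/2}`), and per-Matsubara-integer grid convergence, uniformly on the momentum
grid, eventually in `L` and then in `M`.  ASSEMBLY = `volLimit_of_termwise_freq` (Tannery with frequency-dependent majorants,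
`…VolumeLimitTannery`, ι = ℤ²) + `klsf_summable_sunsetWeight` / `klsf_tsum_sunsetWeight_le` (majorants, `…SunsetFrequencySum`) +
`doubleMomentumAverage_uniform_approx_allSides` / `apply_latticeMomentum_add_sub` (termwise limits, `TorusMomentumProductGrid`) +
`continuous_parametric_integral_of_continuous` (continuity of the limit).  Nothing is asserted about the Hubbard model: the
identification of the `U²`-coefficient of `klSelfEnergy … (nScales β + 1)` with `U² · klSunset` of the frame propagator (plus the
momentum-independent tadpole-insertion term) is the true-carrier computation of the k3c5-p2 lane.

References: G. Benfatto, A. Giuliani, V. Mastropietro, Ann. Henri Poincaré 7 (2006) 809–898, §2.1 (2.3)–(2.8), §2.4 (finite-volume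
perturbation theory on the space-time torus and its `L → ∞` limits); S. Friedli, Y. Velenik, *Statistical Mechanics of Lattice
Systems* (2017) §10.5.2.
-/

noncomputable section

namespace Summit.HubbardSuperconductivity.HubbardSuperconductivity.Theorems.KLRegimeSplit

set_option linter.dupNamespace false -- summit = problem name (single-conjunct summit), D-0017

open MeasureTheory Finset Real Literature.MathematicalPhysics.QuantumLattice Literature.Probability.LatticeModels

/-! ## §1 Definitions: the finite-volume sunset functional and its termwise limit -/

section Model

variable (L M : ℕ) [NeZero L]

/-- **The `(a, b)` term of the finite-volume sunset** at external `(ω, k⃗)`, `n = matsubaraInt M ω`: zero unless `a`, `b` and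
`n + b - a` are kept labels (the `2M` values `[-M, M-1]` of `matsubaraInt M`); otherwise `β⁻² · L⁻² Σ_p L⁻² Σ_q g_a(p_p) g_b(p_q) g_{n+b-a}(p_{k⃗+q-p})` (spin-independent). -/
def klSunsetTerm (β : ℝ) (g : ℤ → (Fin 2 → ℝ) → ℂ) (ab : ℤ × ℤ) (k : FreqMomentum L M) (_σ : Fin 2) : ℂ :=
  if ab.1 ∈ Finset.Icc (-(M : ℤ)) ((M : ℤ) - 1) ∧ ab.2 ∈ Finset.Icc (-(M : ℤ)) ((M : ℤ) - 1) ∧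
      matsubaraInt M k.1 + ab.2 - ab.1 ∈ Finset.Icc (-(M : ℤ)) ((M : ℤ) - 1) then
    ((β ^ 2)⁻¹ : ℝ) • (((L ^ 2 : ℕ) : ℝ)⁻¹ • ∑ p : TorusSite 2 L, ((L ^ 2 : ℕ) : ℝ)⁻¹ • ∑ q : TorusSite 2 L,
      g ab.1 (latticeMomentum L p) * g ab.2 (latticeMomentum L q) *
        g (matsubaraInt M k.1 + ab.2 - ab.1) (latticeMomentum L (k.2 + q - p)))
  else 0

/-- **The finite-volume sunset functional** `Σ_{(a,b) ∈ ℤ²}` of the terms (a finite sum: `klSunset_eq_sum`). -/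
def klSunset (β : ℝ) (g : ℤ → (Fin 2 → ℝ) → ℂ) (k : FreqMomentum L M) (σ : Fin 2) : ℂ :=
  ∑' ab : ℤ × ℤ, klSunsetTerm L M β g ab k σ

end Model

/-- **The termwise limit**: `β⁻² (2π)⁻⁴ ∫_{[-π,π]⁴} g_a(w_I + π) g_b(w_II + π) g_{n+b-a}(z + (w_II + π) - (w_I + π)) dw`. -/
def klSunsetTermLimit (β : ℝ) (g : ℤ → (Fin 2 → ℝ) → ℂ) (ab : ℤ × ℤ) (n : ℤ) (z : Fin 2 → ℝ) (_σ : Fin 2) : ℂ :=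
  ((β ^ 2)⁻¹ : ℝ) • ((((2 * π) ^ (2 + 2))⁻¹ : ℝ) • ∫ w in brillouin (2 + 2),
    g ab.1 (fun i => w (Fin.castAdd 2 i) + π) * g ab.2 (fun j => w (Fin.natAdd 2 j) + π) *
      g (n + ab.2 - ab.1) (fun i => z i + (w (Fin.natAdd 2 i) + π) - (w (Fin.castAdd 2 i) + π)))

/-- **The limit functional** `Σ∞(n, z) = Σ_{(a,b) ∈ ℤ²}` of the termwise limits. -/
def klSunsetLimit (β : ℝ) (g : ℤ → (Fin 2 → ℝ) → ℂ) (n : ℤ) (z : Fin 2 → ℝ) (σ : Fin 2) : ℂ :=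
  ∑' ab : ℤ × ℤ, klSunsetTermLimit β g ab n z σ

/-! ## §2 Elementary facts: finite support, the value of a momentum average, the volume of the zone -/

/-- Every label is kept once `M` exceeds its size. -/
theorem klsn_mem_Icc_of_natAbs_lt {M : ℕ} {c : ℤ} (h : c.natAbs < M) : c ∈ Finset.Icc (-(M : ℤ)) ((M : ℤ) - 1) := by
  rw [Finset.mem_Icc]; omega

section Model

variable {L M : ℕ} [NeZero L]

/-- The sunset term vanishes off the square `[-M, M-1]²`. -/
theorem klSunsetTerm_eq_zero_of_not_mem (β : ℝ) (g : ℤ → (Fin 2 → ℝ) → ℂ) (k : FreqMomentum L M) (σ : Fin 2)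
    {ab : ℤ × ℤ} (hab : ab ∉ Finset.Icc (-(M : ℤ)) ((M : ℤ) - 1) ×ˢ Finset.Icc (-(M : ℤ)) ((M : ℤ) - 1)) :
    klSunsetTerm L M β g ab k σ = 0 := by
  unfold klSunsetTerm
  rw [if_neg]
  intro h
  apply hab
  rw [Finset.mem_product]
  exact ⟨h.1, h.2.1⟩

/-- The termwise family has finite support, hence is summable. -/
theorem summable_klSunsetTerm (β : ℝ) (g : ℤ → (Fin 2 → ℝ) → ℂ) (k : FreqMomentum L M) (σ : Fin 2) :
    Summable fun ab : ℤ × ℤ => klSunsetTerm L M β g ab k σ :=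
  summable_of_ne_finset_zero fun _ hab => klSunsetTerm_eq_zero_of_not_mem β g k σ hab

/-- **The termwise representation** (`HasSum`). -/
theorem hasSum_klSunsetTerm (β : ℝ) (g : ℤ → (Fin 2 → ℝ) → ℂ) (k : FreqMomentum L M) (σ : Fin 2) :
    HasSum (fun ab : ℤ × ℤ => klSunsetTerm L M β g ab k σ) (klSunset L M β g k σ) :=
  (summable_klSunsetTerm β g k σ).hasSum

/-- **The sunset is a finite sum** over the square of kept labels. -/
theorem klSunset_eq_sum (β : ℝ) (g : ℤ → (Fin 2 → ℝ) → ℂ) (k : FreqMomentum L M) (σ : Fin 2) :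
    klSunset L M β g k σ =
      ∑ ab ∈ Finset.Icc (-(M : ℤ)) ((M : ℤ) - 1) ×ˢ Finset.Icc (-(M : ℤ)) ((M : ℤ) - 1), klSunsetTerm L M β g ab k σ :=
  tsum_eq_sum fun _ hab => klSunsetTerm_eq_zero_of_not_mem β g k σ hab

omit [NeZero L] in
/-- A momentum average is bounded by the sup of its terms. -/
theorem norm_momentumAverage_le [NeZero L] {d : ℕ} {F : TorusSite d L → ℂ} {A : ℝ} (hF : ∀ p, ‖F p‖ ≤ A) :
    ‖((L ^ d : ℕ) : ℝ)⁻¹ • ∑ p : TorusSite d L, F p‖ ≤ A := by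
  have hLd : (0 : ℝ) < ((L ^ d : ℕ) : ℝ) := by exact_mod_cast pow_pos (Nat.pos_of_ne_zero (NeZero.ne L)) d
  rw [norm_smul, norm_inv, Real.norm_of_nonneg hLd.le, inv_mul_le_iff₀ hLd]
  calc ‖∑ p : TorusSite d L, F p‖ ≤ ∑ p : TorusSite d L, ‖F p‖ := norm_sum_le _ _
    _ ≤ ∑ _p : TorusSite d L, A := Finset.sum_le_sum fun p _ => hF p
    _ = ((L ^ d : ℕ) : ℝ) * A := by
        rw [Finset.sum_const, Finset.card_univ, card_torusSite, nsmul_eq_mul]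

/-- Lattice momenta lie in the cube `[0, 2π]^d`. -/
theorem latticeMomentum_mem_cube {d : ℕ} (k : TorusSite d L) :
    latticeMomentum L k ∈ Set.pi Set.univ fun _ : Fin d => Set.Icc (0 : ℝ) (2 * π) := by
  intro i _
  have hL : (0 : ℝ) < L := by exact_mod_cast Nat.pos_of_ne_zero (NeZero.ne L)
  have hv : ((k i).val : ℝ) ≤ L := by exact_mod_cast (ZMod.val_lt (k i)).le
  simp only [latticeMomentum, Set.mem_Icc]
  constructor
  · positivity
  · rw [div_le_iff₀ hL]
    nlinarith [Real.pi_pos]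

end Model

/-- The volume of the zone `[-π,π]^d` is `(2π)^d`. -/
theorem volume_real_brillouin (d : ℕ) : volume.real (brillouin d) = (2 * π) ^ d := by
  rw [Measure.real, show brillouin d = Set.pi Set.univ (fun _ : Fin d => Set.Icc (-π) π) from rfl, volume_pi_pi]
  simp only [Real.volume_Icc, Finset.prod_const, Finset.card_univ, Fintype.card_fin, ENNReal.toReal_pow,
    ENNReal.toReal_ofReal (by linarith [Real.pi_pos] : (0 : ℝ) ≤ π - -π)]
  ring

/-! ## §3 The model-free sunset theorem -/

/-- **The sunset rung of the volume-limit slot (model-free).**  For `β > 0` and an admissible symbol family `g` (each `g_a` continuous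
and `2π`-periodic, `‖g_a(x)‖ ≤ C/|a+½|`), and for EVERY threshold function `Mstar`, the finite-volume sunset functional
`klSunset L M β g` has a momentum-continuous limit with an `n`-uniform bound and per-Matsubara-integer grid convergence, uniformly
on the momentum grid, eventually in `L` and then in `M` — the three clauses of `FinalTwoLegVolLimit`, verbatim, for this carrier. -/
theorem klSunset_volLimit {β : ℝ} (hβ : 0 < β) {g : ℤ → (Fin 2 → ℝ) → ℂ} {C : ℝ} (hC : 0 ≤ C)
    (hg_cont : ∀ a : ℤ, Continuous (g a))
    (hg_per : ∀ (a : ℤ) (x : Fin 2 → ℝ) (m : Fin 2 → ℤ), g a (fun i => x i + 2 * π * (m i : ℝ)) = g a x)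
    (hg_bdd : ∀ (a : ℤ) (x : Fin 2 → ℝ), ‖g a x‖ ≤ C / |(a : ℝ) + 1 / 2|) (Mstar : ℕ → ℕ) :
    ∃ sigmaInf : ℤ → (Fin 2 → ℝ) → Fin 2 → ℂ, ∃ B : ℝ, ∃ L₀' : ℕ,
      (∀ (n : ℤ) (σ : Fin 2), Continuous fun p : Fin 2 → ℝ => sigmaInf n p σ) ∧
      (∀ (L : ℕ) [NeZero L], L₀' ≤ L → ∀ (M : ℕ) [NeZero M], Mstar L ≤ M →
        ∀ (k : FreqMomentum L M) (σ : Fin 2), ‖klSunset L M β g k σ‖ ≤ B) ∧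
      (∀ (n : ℤ) (σ : Fin 2) (ε : ℝ), 0 < ε → ∃ L₁ : ℕ, ∀ (L : ℕ) [NeZero L], L₁ ≤ L →
        ∃ M₁ : ℕ, ∀ (M : ℕ) [NeZero M], M₁ ≤ M → ∀ ω : MatsubaraIdx M, matsubaraInt M ω = n →
          ∀ k : TorusSite 2 L, ‖klSunset L M β g (ω, k) σ - sigmaInf n (latticeMomentum L k) σ‖ ≤ ε) := by
  -- the frequency-dependent majorant family
  set m : ℤ → ℤ × ℤ → ℝ := fun n ab =>
    (β ^ 2)⁻¹ * C ^ 3 * (|(ab.1 : ℝ) + 1 / 2| * |(ab.2 : ℝ) + 1 / 2| * |((n + ab.2 - ab.1 : ℤ) : ℝ) + 1 / 2|)⁻¹ with hm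
  have hK : 0 ≤ (β ^ 2)⁻¹ * C ^ 3 := by positivity
  -- pointwise bound of a product of three symbols
  have hprod3 : ∀ (a b c : ℤ) (x y z : Fin 2 → ℝ),
      ‖g a x * g b y * g c z‖ ≤ C ^ 3 * (|(a : ℝ) + 1 / 2| * |(b : ℝ) + 1 / 2| * |(c : ℝ) + 1 / 2|)⁻¹ := by
    intro a b c x y z
    have ha := klsf_abs_add_half_pos a
    have hb := klsf_abs_add_half_pos b
    have hc := klsf_abs_add_half_pos c
    rw [norm_mul, norm_mul]
    calc ‖g a x‖ * ‖g b y‖ * ‖g c z‖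
        ≤ C / |(a : ℝ) + 1 / 2| * (C / |(b : ℝ) + 1 / 2|) * (C / |(c : ℝ) + 1 / 2|) :=
          mul_le_mul (mul_le_mul (hg_bdd a x) (hg_bdd b y) (norm_nonneg _) (div_nonneg hC ha.le)) (hg_bdd c z)
            (norm_nonneg _) (mul_nonneg (div_nonneg hC ha.le) (div_nonneg hC hb.le))
      _ = C ^ 3 * (|(a : ℝ) + 1 / 2| * |(b : ℝ) + 1 / 2| * |(c : ℝ) + 1 / 2|)⁻¹ := by
          field_simp
  refine volLimit_of_termwise_freq (S := fun L M _ _ k σ => klSunset L M β g k σ) (Mstar := Mstar) (ι := ℤ × ℤ)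
    (v := fun ab L M _ _ k σ => klSunsetTerm L M β g ab k σ) (vInf := fun ab n z σ => klSunsetTermLimit β g ab n z σ)
    (m := m) (fun n => (klsf_summable_sunsetWeight n).mul_left _) (B := (β ^ 2)⁻¹ * C ^ 3 *
      (3 * (∑' a : ℤ, (|(a : ℝ) + 1 / 2| * Real.sqrt |(a : ℝ) + 1 / 2|)⁻¹) ^ 2)) ?_ (L₀ := 0) ?_ ?_ ?_ ?_ ?_
  · -- `Σ' m n ≤ B`, uniformly in `n`
    intro n
    rw [hm, tsum_mul_left]
    exact mul_le_mul_of_nonneg_left (klsf_tsum_sunsetWeight_le n) hK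
  · -- termwise representation
    intro L _ _ M _ _ k σ
    exact hasSum_klSunsetTerm β g k σ
  · -- termwise majorants
    intro ab L _ _ M _ _ ω k σ
    have hm0 : 0 ≤ m (matsubaraInt M ω) ab := by
      have := klsf_abs_add_half_pos ab.1
      have := klsf_abs_add_half_pos ab.2
      have := klsf_abs_add_half_pos (matsubaraInt M ω + ab.2 - ab.1)
      positivity
    show ‖klSunsetTerm L M β g ab (ω, k) σ‖ ≤ m (matsubaraInt M ω) ab
    unfold klSunsetTerm
    split_ifs with h
    · rw [norm_smul, norm_inv, norm_pow, Real.norm_of_nonneg hβ.le, hm]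
      simp only
      rw [mul_assoc ((β ^ 2)⁻¹)]
      refine mul_le_mul_of_nonneg_left ?_ (by positivity)
      refine norm_momentumAverage_le fun p => norm_momentumAverage_le fun q => ?_
      exact hprod3 _ _ _ _ _ _
    · rw [norm_zero]; exact hm0
  · -- continuity of the termwise limits
    intro ab n σ
    show Continuous fun z : Fin 2 → ℝ => klSunsetTermLimit β g ab n z σ
    unfold klSunsetTermLimit
    have hunc : Continuous (Function.uncurry fun (z : Fin 2 → ℝ) (w : Fin (2 + 2) → ℝ) =>
        g ab.1 (fun i => w (Fin.castAdd 2 i) + π) * g ab.2 (fun j => w (Fin.natAdd 2 j) + π) *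
          g (n + ab.2 - ab.1) (fun i => z i + (w (Fin.natAdd 2 i) + π) - (w (Fin.castAdd 2 i) + π))) := by
      refine ((?_ : Continuous _).mul ?_).mul ?_
      · exact (hg_cont ab.1).comp (continuous_pi fun i =>
          ((continuous_apply _).comp continuous_snd).add continuous_const)
      · exact (hg_cont ab.2).comp (continuous_pi fun j =>
          ((continuous_apply _).comp continuous_snd).add continuous_const)
      · refine (hg_cont _).comp (continuous_pi fun i => ?_)
        have h1 : Continuous fun q : (Fin 2 → ℝ) × (Fin (2 + 2) → ℝ) => q.1 i :=
          (continuous_apply i).comp continuous_fst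
        have h2 : Continuous fun q : (Fin 2 → ℝ) × (Fin (2 + 2) → ℝ) => q.2 (Fin.natAdd 2 i) :=
          (continuous_apply (Fin.natAdd 2 i)).comp continuous_snd
        have h3 : Continuous fun q : (Fin 2 → ℝ) × (Fin (2 + 2) → ℝ) => q.2 (Fin.castAdd 2 i) :=
          (continuous_apply (Fin.castAdd 2 i)).comp continuous_snd
        exact (h1.add (h2.add continuous_const)).sub (h3.add continuous_const)
    have hI := continuous_parametric_integral_of_continuous (μ := volume) hunc (isCompact_brillouin (2 + 2))
    exact (hI.const_smul (((2 * π) ^ (2 + 2))⁻¹ : ℝ)).const_smul ((β ^ 2)⁻¹ : ℝ)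
  · -- the termwise limits obey the same majorants
    intro ab n z σ
    have h2π : (0 : ℝ) < (2 * π) ^ (2 + 2) := by positivity
    show ‖klSunsetTermLimit β g ab n z σ‖ ≤ m n ab
    unfold klSunsetTermLimit
    rw [norm_smul, norm_smul, norm_inv, norm_inv, norm_pow, norm_pow, Real.norm_of_nonneg hβ.le,
      Real.norm_of_nonneg (by positivity : (0 : ℝ) ≤ 2 * π), hm]
    simp only
    rw [mul_assoc ((β ^ 2)⁻¹)]
    refine mul_le_mul_of_nonneg_left ?_ (by positivity)
    rw [inv_mul_le_iff₀ h2π]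
    have hint := norm_setIntegral_le_of_norm_le_const ((isCompact_brillouin (2 + 2)).measure_lt_top (μ := volume))
      (f := fun w : Fin (2 + 2) → ℝ => g ab.1 (fun i => w (Fin.castAdd 2 i) + π) * g ab.2 (fun j => w (Fin.natAdd 2 j) + π) *
        g (n + ab.2 - ab.1) (fun i => z i + (w (Fin.natAdd 2 i) + π) - (w (Fin.castAdd 2 i) + π)))
      (fun w _ => hprod3 ab.1 ab.2 (n + ab.2 - ab.1) _ _ _)
    rw [volume_real_brillouin] at hint
    calc _ ≤ C ^ 3 * (|(ab.1 : ℝ) + 1 / 2| * |(ab.2 : ℝ) + 1 / 2| * |((n + ab.2 - ab.1 : ℤ) : ℝ) + 1 / 2|)⁻¹ *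
          (2 * π) ^ (2 + 2) := hint
      _ = (2 * π) ^ (2 + 2) * (C ^ 3 * (|(ab.1 : ℝ) + 1 / 2| * |(ab.2 : ℝ) + 1 / 2| *
          |((n + ab.2 - ab.1 : ℤ) : ℝ) + 1 / 2|)⁻¹) := by ring
  · -- termwise grid convergence: eventually in `M` the indicator is `1`, then a double Riemann sum uniformly in `p_k`
    intro ab n σ ε hε
    obtain ⟨a, b⟩ := ab
    set c : ℤ := n + b - a with hc
    -- the combined integrand
    set G : (Fin 2 → ℝ) → (Fin 2 → ℝ) → (Fin 2 → ℝ) → ℂ :=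
      fun x y z => g a x * g b y * g c (fun i => z i + y i - x i) with hG
    have hGc : Continuous fun q : ((Fin 2 → ℝ) × (Fin 2 → ℝ)) × (Fin 2 → ℝ) => G q.1.1 q.1.2 q.2 := by
      refine ((?_ : Continuous _).mul ?_).mul ?_
      · exact (hg_cont a).comp (continuous_fst.comp continuous_fst)
      · exact (hg_cont b).comp (continuous_snd.comp continuous_fst)
      · exact (hg_cont c).comp (continuous_pi fun i =>
          (((continuous_apply i).comp continuous_snd).add
            ((continuous_apply i).comp (continuous_snd.comp continuous_fst))).sub
            ((continuous_apply i).comp (continuous_fst.comp continuous_fst)))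
    have hcube : IsCompact (Set.pi Set.univ fun _ : Fin 2 => Set.Icc (0 : ℝ) (2 * π)) :=
      isCompact_univ_pi fun _ => isCompact_Icc
    have hε' : 0 < β ^ 2 * ε := by positivity
    obtain ⟨L₀, hL₀⟩ := doubleMomentumAverage_uniform_approx_allSides (d₁ := 2) (d₂ := 2) hcube hGc.continuousOn hε'
    refine ⟨L₀, fun L _ hL => ⟨a.natAbs + b.natAbs + c.natAbs + 1, fun M _ hM ω hω k => ?_⟩⟩
    have ha : a ∈ Finset.Icc (-(M : ℤ)) ((M : ℤ) - 1) := klsn_mem_Icc_of_natAbs_lt (by omega)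
    have hb : b ∈ Finset.Icc (-(M : ℤ)) ((M : ℤ) - 1) := klsn_mem_Icc_of_natAbs_lt (by omega)
    have hc' : matsubaraInt M ω + b - a ∈ Finset.Icc (-(M : ℤ)) ((M : ℤ) - 1) := by
      rw [hω]; exact klsn_mem_Icc_of_natAbs_lt (by omega)
    have happrox := hL₀ L hL (latticeMomentum L k) (latticeMomentum_mem_cube k)
    -- unfold both sides
    show ‖klSunsetTerm L M β g (a, b) (ω, k) σ - klSunsetTermLimit β g (a, b) n (latticeMomentum L k) σ‖ ≤ ε
    unfold klSunsetTerm klSunsetTermLimit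
    rw [if_pos ⟨ha, hb, hc'⟩]
    simp only
    rw [hω]
    -- the third symbol at the conserved momentum
    have hthird : ∀ p q : TorusSite 2 L, g (n + b - a) (latticeMomentum L (k + q - p)) =
        g (n + b - a) (fun i => latticeMomentum L k i + latticeMomentum L q i - latticeMomentum L p i) :=
      fun p q => apply_latticeMomentum_add_sub (hg_per (n + b - a)) k q p
    simp_rw [hthird]
    rw [← smul_sub, norm_smul, norm_inv, norm_pow, Real.norm_of_nonneg hβ.le, inv_mul_le_iff₀ (by positivity)]
    have hGdef : ∀ x y z, G x y z = g a x * g b y * g c (fun i => z i + y i - x i) := fun x y z => rfl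
    have hint_eq : (fun w : Fin (2 + 2) → ℝ => g a (fun i => w (Fin.castAdd 2 i) + π) * g b (fun j => w (Fin.natAdd 2 j) + π) *
        g c (fun i => latticeMomentum L k i + (w (Fin.natAdd 2 i) + π) - (w (Fin.castAdd 2 i) + π))) =
        fun w => G (fun i => w (Fin.castAdd 2 i) + π) (fun j => w (Fin.natAdd 2 j) + π) (latticeMomentum L k) := by
      funext w; rw [hGdef]
    have hsum_eq : (fun p : TorusSite 2 L => ((L ^ 2 : ℕ) : ℝ)⁻¹ • ∑ q : TorusSite 2 L,
        g a (latticeMomentum L p) * g b (latticeMomentum L q) *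
          g c (fun i => latticeMomentum L k i + latticeMomentum L q i - latticeMomentum L p i)) =
        fun p => ((L ^ 2 : ℕ) : ℝ)⁻¹ • ∑ q : TorusSite 2 L, G (latticeMomentum L p) (latticeMomentum L q) (latticeMomentum L k) := by
      funext p; simp only [hGdef]
    rw [hint_eq, hsum_eq]
    exact happrox

end Summit.HubbardSuperconductivity.HubbardSuperconductivity.Theorems.KLRegimeSplit

end
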